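import Literature.Combinatorics.Optimization.BlockPsdFactorization
import Literature.Barriers.PneNP.PMPolytopeEdmondsDescription
import HarnessLib

/-!
# `(S^b_+)^m`-lifts of the perfect matching polytope versus block psd factorizations of its odd-cut
# slack matrix: the equivalence (Gouveia–Parrilo–Thomas / Fawzi–Parrilo + Edmonds)

Everything here is PROVED; no facts are asserted.  The rung "`(S²₊)^m`-lifts (second-order-cone lifts) of
`P_PM(n)` need `m ≥ 2^{Ω(n)}`" of cell pnp-psdrank is typed in the FACTORIZATION currency
`HasBlockPsdFactorization n b m` (`BlockPsdFactorization.lean`: the odd-cut slack matrix `|δ(U) ∩ M| − 1` has a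
psd factorization with `m` blocks of size `b`).  `BlockPsdFactorization.lean` §6 proves
"(S^b_+)^m-lift of `pmPolytope n` ⇒ `HasBlockPsdFactorization n b m`" (Gouveia–Parrilo–Thomas / Fawzi–Parrilo,
direction lift ⇒ factorization [cite: FawziParrilo2013, Thm. 2 (§2.1, p. 6)]).  This file proves the CONVERSE
up to `|E(K_n)| = C(n,2)` blocks, closing the dictionary:

* `FixedSizePsdRank.HasPsdPowerFactorization.add` (`(S^d_+)^r × (S^d_+)^s = (S^d_+)^{r+s}`),
  `hasPsdPowerFactorization_of_fintype` (blocks indexed by any finite type).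
* Edmonds' description of `P_PM(K_n)` [cite: Edmonds1965, §2 Thm. (P)] [cite: KorteVygen2018, Thm. 11.15 (p. 297)]
  (the tree's `pmPolytope_eq_setOf`) as ONE inequality system `a_j ⬝ᵥ x ≤ b_j`, `j ∈ EdmondsRow n =
  OddSet n ⊕ E(K_n) ⊕ (Fin n ⊕ Fin n)` (`edmondsA`, `edmondsB`, `convexHull_range_pmVertex_eq_setOf`), and the
  slacks of this system at the perfect matchings (`edmonds_slack_eq`: `|δ(U) ∩ M| − 1`, `χ^M_e`, `0`, `0`).
* `HasBlockPsdFactorization.hasPsdPowerFactorization_edmonds`: a block factorization of the odd-cut slack matrix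
  extends to the FULL Edmonds slack matrix with `C(n,2)` extra blocks (one scalar block per edge row `x_e ≥ 0`).
* `HasBlockPsdFactorization.hasBlockPsdLift`: **`HasBlockPsdFactorization n b m` (`b, m ≥ 1`) ⇒ `P_PM(K_n)` has an
  `(S^b_+)^{m + C(n,2)}`-lift**, by Gouveia–Parrilo–Thomas Thm. 2.4 for `(S^b_+)^r`
  (`hasPsdPowerFactorization_slack_iff_hasBlockPsdLift`, `BlockPsdLiftFactorization.lean`)
  [cite: GouveiaParriloThomas2013, Thm. 2.4 (§2)]; `le_add_card_of_lift_bound` restates it as a transfer of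
  lower bounds.  So lower bounds of the form `2^{Ω(n)}` are the same statement in either currency.
-/

noncomputable section

open Finset Matrix
open scoped MatrixOrder

namespace Literature.Combinatorics.Optimization

open Literature.Barriers.PneNP FixedSizePsdRank

/-! ### Sums of `(S^d_+)^r`- and `(S^d_+)^s`-factorizations -/

/-- **`(S^d_+)^r × (S^d_+)^s = (S^d_+)^{r+s}`**: the sum of a matrix with an `(S^d_+)^r`-factorization and one
with an `(S^d_+)^s`-factorization has an `(S^d_+)^{r+s}`-factorization (concatenate the blocks).
[cite: FawziParrilo2013, §1.2 (p. 5, "M = M_1 + ⋯ + M_r")] -/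
theorem FixedSizePsdRank.HasPsdPowerFactorization.add {ι κ : Type*} {M N : ι → κ → ℝ} {d r s : ℕ}
    (hM : HasPsdPowerFactorization M d r) (hN : HasPsdPowerFactorization N d s) :
    HasPsdPowerFactorization (fun i j => M i j + N i j) d (r + s) := by
  obtain ⟨A, B, hA, hB, hAB⟩ := hM
  obtain ⟨A', B', hA', hB', hAB'⟩ := hN
  refine ⟨fun i => Fin.append (A i) (A' i), fun j => Fin.append (B j) (B' j), fun i t => ?_, fun j t => ?_,
    fun i j => ?_⟩
  · refine Fin.addCases (fun t => ?_) (fun t => ?_) t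
    · change (Fin.append (A i) (A' i) (Fin.castAdd s t)).PosSemidef
      rw [Fin.append_left]; exact hA i t
    · change (Fin.append (A i) (A' i) (Fin.natAdd r t)).PosSemidef
      rw [Fin.append_right]; exact hA' i t
  · refine Fin.addCases (fun t => ?_) (fun t => ?_) t
    · change (Fin.append (B j) (B' j) (Fin.castAdd s t)).PosSemidef
      rw [Fin.append_left]; exact hB j t
    · change (Fin.append (B j) (B' j) (Fin.natAdd r t)).PosSemidef
      rw [Fin.append_right]; exact hB' j t
  · change M i j + N i j = ∑ t, (Fin.append (A i) (A' i) t * Fin.append (B j) (B' j) t).trace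
    rw [hAB, hAB', Fin.sum_univ_add]
    simp only [Fin.append_left, Fin.append_right]

/-- Re-indexing the blocks along an equivalence `ι' ≃ Fin r`: a factorization with blocks indexed by any finite
type of cardinality `r` is an `(S^d_+)^r`-factorization. [cite: FawziParrilo2013, §1.2 (p. 5)] -/
theorem FixedSizePsdRank.hasPsdPowerFactorization_of_fintype {ι κ τ : Type*} [Fintype τ] {M : ι → κ → ℝ}
    {d r : ℕ} (hr : Fintype.card τ = r) (A : ι → τ → Matrix (Fin d) (Fin d) ℝ)
    (B : κ → τ → Matrix (Fin d) (Fin d) ℝ) (hA : ∀ i t, (A i t).PosSemidef) (hB : ∀ j t, (B j t).PosSemidef)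
    (hM : ∀ i j, M i j = ∑ t, (A i t * B j t).trace) : HasPsdPowerFactorization M d r := by
  let e : τ ≃ Fin r := Fintype.equivFinOfCardEq hr
  refine ⟨fun i t => A i (e.symm t), fun j t => B j (e.symm t), fun i t => hA _ _, fun j t => hB _ _,
    fun i j => ?_⟩
  change M i j = ∑ t, (A i (e.symm t) * B j (e.symm t)).trace
  rw [hM i j]
  exact Fintype.sum_equiv e _ _ fun t => by rw [Equiv.symm_apply_apply]

variable {n : ℕ}

/-! ### Edmonds' description of `P_PM(K_n)` as one inequality system -/

/-- The index set of Edmonds' inequalities for `P_PM(K_n)`: odd sets (`x(δ(U)) ≥ 1`), edges (`x_e ≥ 0`), and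
vertices twice (`x(δ(v)) ≤ 1`, `x(δ(v)) ≥ 1`). [cite: KorteVygen2018, Thm. 11.15 (p. 297)] -/
abbrev EdmondsRow (n : ℕ) : Type := OddSet n ⊕ EKn n ⊕ (Fin n ⊕ Fin n)

/-- The degree functional of a vertex: `x ↦ x(δ(v))`. [cite: KorteVygen2018, Thm. 11.15 (p. 297)] -/
def degVec (v : Fin n) : EKn n → ℝ := fun e => if v ∈ (e : Sym2 (Fin n)) then 1 else 0

/-- `degVec v ⬝ᵥ x = Σ_{e ∋ v} x_e`. [cite: KorteVygen2018, Thm. 11.15 (p. 297)] -/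
theorem degVec_dotProduct (v : Fin n) (x : EKn n → ℝ) :
    degVec v ⬝ᵥ x = ∑ e ∈ univ.filter (fun e : EKn n => v ∈ (e : Sym2 (Fin n))), x e := by
  simp only [dotProduct, degVec, ite_mul, one_mul, zero_mul]
  rw [Finset.sum_filter]

/-- Normals of Edmonds' inequalities, written as `a_j ⬝ᵥ x ≤ b_j`. [cite: KorteVygen2018, Thm. 11.15 (p. 297)] -/
def edmondsA : EdmondsRow n → EKn n → ℝ
  | Sum.inl U => oddCutVec U.1
  | Sum.inr (Sum.inl e) => -Pi.single e 1
  | Sum.inr (Sum.inr (Sum.inl v)) => degVec v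
  | Sum.inr (Sum.inr (Sum.inr v)) => -degVec v

/-- Right-hand sides of Edmonds' inequalities. [cite: KorteVygen2018, Thm. 11.15 (p. 297)] -/
def edmondsB : EdmondsRow n → ℝ
  | Sum.inl _ => -1
  | Sum.inr (Sum.inl _) => 0
  | Sum.inr (Sum.inr (Sum.inl _)) => 1
  | Sum.inr (Sum.inr (Sum.inr _)) => -1

/-- The vertices of `P_PM(K_n)`: characteristic vectors of perfect matchings. [cite: Rothvoss2017, §1 (PDF p. 4)] -/
def pmVertex (M : PMatch n) : EKn n → ℝ := charVec M.1

/-- `P_PM(K_n) = conv{χ^M : M ∈ PMatch n}`. [cite: Rothvoss2017, §1 (PDF p. 4)] -/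
theorem convexHull_range_pmVertex (n : ℕ) : convexHull ℝ (Set.range (pmVertex (n := n))) = pmPolytope n := by
  unfold pmPolytope
  congr 1
  ext x
  constructor
  · rintro ⟨M, rfl⟩; exact ⟨M.1, M.2, rfl⟩
  · rintro ⟨M, hM, rfl⟩; exact ⟨⟨M, hM⟩, rfl⟩

/-- **Edmonds' theorem as `conv{χ^M} = {x : a_j ⬝ᵥ x ≤ b_j}`** over the row set `EdmondsRow n`.
[cite: Edmonds1965, §2 Thm. (P) (p. 126), perfect-matching form] [cite: KorteVygen2018, Thm. 11.15 (p. 297)] -/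
theorem convexHull_range_pmVertex_eq_setOf (n : ℕ) :
    convexHull ℝ (Set.range (pmVertex (n := n))) = {x | ∀ j : EdmondsRow n, edmondsA j ⬝ᵥ x ≤ edmondsB j} := by
  classical
  rw [convexHull_range_pmVertex, pmPolytope_eq_setOf]
  ext x
  simp only [Set.mem_setOf_eq]
  constructor
  · rintro ⟨h0, hdeg, hcut⟩ j
    rcases j with U | e | v | v
    · exact hcut U.1 U.2
    · change -Pi.single e (1 : ℝ) ⬝ᵥ x ≤ 0
      rw [neg_dotProduct, single_dotProduct, one_mul, neg_nonpos]
      exact h0 e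
    · change degVec v ⬝ᵥ x ≤ 1
      rw [degVec_dotProduct, hdeg v]
    · change -degVec v ⬝ᵥ x ≤ -1
      rw [neg_dotProduct, degVec_dotProduct, hdeg v]
  · intro h
    refine ⟨fun e => ?_, fun v => ?_, fun U hU => h (Sum.inl ⟨U, hU⟩)⟩
    · have := h (Sum.inr (Sum.inl e))
      change -Pi.single e (1 : ℝ) ⬝ᵥ x ≤ 0 at this
      rwa [neg_dotProduct, single_dotProduct, one_mul, neg_nonpos] at this
    · have h1 := h (Sum.inr (Sum.inr (Sum.inl v)))
      have h2 := h (Sum.inr (Sum.inr (Sum.inr v)))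
      change degVec v ⬝ᵥ x ≤ 1 at h1
      change -degVec v ⬝ᵥ x ≤ -1 at h2
      rw [neg_dotProduct] at h2
      rw [degVec_dotProduct] at h1 h2
      linarith

/-! ### The full Edmonds slack matrix and its block factorizations -/

/-- The slacks of Edmonds' inequalities at the perfect matchings: `|δ(U) ∩ M| − 1` (odd sets), `χ^M_e`
(edges), `0` (degree rows). [cite: Rothvoss2017, §2 (PDF p. 5)] -/
theorem edmonds_slack_eq (M : PMatch n) (j : EdmondsRow n) :
    edmondsB j - edmondsA j ⬝ᵥ pmVertex M =
      (match j with
        | Sum.inl U => pmOddCutSlack n U M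
        | Sum.inr (Sum.inl e) => charVec M.1 e
        | Sum.inr (Sum.inr _) => 0) := by
  classical
  rcases j with U | e | v | v
  · change (-1 : ℝ) - oddCutVec U.1 ⬝ᵥ charVec M.1 = pmOddCutSlack n U M
    rw [oddCut_slack U.1 M.2, pmOddCutSlack_eq_pmSlack, pmSlack]
  · change (0 : ℝ) - -Pi.single e (1 : ℝ) ⬝ᵥ charVec M.1 = charVec M.1 e
    rw [neg_dotProduct, single_dotProduct, one_mul, sub_neg_eq_add, zero_add]
  · change (1 : ℝ) - degVec v ⬝ᵥ charVec M.1 = 0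
    rw [degVec_dotProduct, sum_charVec_incident M.2 v, sub_self]
  · change (-1 : ℝ) - -degVec v ⬝ᵥ charVec M.1 = 0
    rw [neg_dotProduct, degVec_dotProduct, sum_charVec_incident M.2 v]
    ring

/-- **A block psd factorization of the odd-cut slack matrix extends to the FULL Edmonds slack matrix with
`|E(K_n)|` extra blocks** (`b ≥ 1`): the odd-cut rows use the given `m` blocks; the edge rows `x_e ≥ 0`
(slack `χ^M_e ∈ {0,1}`) use one scalar block `χ^M_e · I_b`, `I_b/b` per edge; the degree rows have slack `0`.
[cite: FawziParrilo2013, §1.2 (p. 5)] [cite: Rothvoss2017, §2 (PDF p. 5)] -/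
theorem HasBlockPsdFactorization.hasPsdPowerFactorization_edmonds {b m : ℕ} (hb : 1 ≤ b)
    (h : HasBlockPsdFactorization n b m) :
    HasPsdPowerFactorization (fun (M : PMatch n) (j : EdmondsRow n) => edmondsB j - edmondsA j ⬝ᵥ pmVertex M)
      b (m + Fintype.card (EKn n)) := by
  classical
  obtain ⟨A, B, hA, hB, hS⟩ := hasBlockPsdFactorization_iff.1 h
  -- part 1: odd-cut rows
  have h1 : HasPsdPowerFactorization (fun (M : PMatch n) (j : EdmondsRow n) =>
      match j with
        | Sum.inl U => pmOddCutSlack n U M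
        | Sum.inr _ => 0) b m := by
    refine ⟨A, fun j => match j with
        | Sum.inl U => B U
        | Sum.inr _ => fun _ => 0, hA, fun j t => ?_, fun M j => ?_⟩
    · rcases j with U | _
      · exact hB U t
      · exact PosSemidef.zero
    · rcases j with U | _
      · exact hS U M
      · simp
  -- part 2: edge rows, one scalar block per edge
  have hb0 : (b : ℝ) ≠ 0 := by exact_mod_cast Nat.one_le_iff_ne_zero.mp hb
  have h2 : HasPsdPowerFactorization (fun (M : PMatch n) (j : EdmondsRow n) =>
      match j with
        | Sum.inr (Sum.inl e) => charVec M.1 e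
        | _ => 0) b (Fintype.card (EKn n)) := by
    refine hasPsdPowerFactorization_of_fintype rfl
      (fun M e => charVec M.1 e • (1 : Matrix (Fin b) (Fin b) ℝ))
      (fun j e => match j with
        | Sum.inr (Sum.inl e') => if e' = e then (b : ℝ)⁻¹ • (1 : Matrix (Fin b) (Fin b) ℝ) else 0
        | _ => 0)
      (fun M e => PosSemidef.one.smul (charVec_nonneg M.1 e)) (fun j e => ?_) (fun M j => ?_)
    · rcases j with U | e' | v | v
      · exact PosSemidef.zero
      · change (if e' = e then (b : ℝ)⁻¹ • (1 : Matrix (Fin b) (Fin b) ℝ) else 0).PosSemidef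
        split_ifs
        · exact PosSemidef.one.smul (inv_nonneg.2 (Nat.cast_nonneg b))
        · exact PosSemidef.zero
      · exact PosSemidef.zero
      · exact PosSemidef.zero
    · rcases j with U | e' | v | v
      · simp
      · change charVec M.1 e' = ∑ e, (charVec M.1 e • (1 : Matrix (Fin b) (Fin b) ℝ) *
          (if e' = e then (b : ℝ)⁻¹ • (1 : Matrix (Fin b) (Fin b) ℝ) else 0)).trace
        rw [Finset.sum_eq_single e']
        · rw [if_pos rfl, Matrix.smul_mul, Matrix.mul_smul, Matrix.one_mul, trace_smul, trace_smul, trace_one,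
            Fintype.card_fin, smul_eq_mul, smul_eq_mul]
          field_simp
        · intro e _ hne
          rw [if_neg (Ne.symm hne), Matrix.mul_zero, trace_zero]
        · intro h; exact absurd (Finset.mem_univ _) h
      · simp
      · simp
  have hsum := h1.add h2
  refine (show (fun (M : PMatch n) (j : EdmondsRow n) => edmondsB j - edmondsA j ⬝ᵥ pmVertex M) = _ from ?_) ▸ hsum
  funext M j
  rw [edmonds_slack_eq]
  rcases j with U | e | v | v <;> simp

/-! ### The equivalence -/

/-- `P_PM(K_n)` is bounded. [cite: Rothvoss2017, §1 (PDF p. 4)] -/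
theorem isBounded_convexHull_pmVertex (n : ℕ) :
    Bornology.IsBounded (convexHull ℝ (Set.range (pmVertex (n := n)))) :=
  isBounded_convexHull.2 (Set.finite_range _).isBounded

/-- **Block psd factorizations give `(S^b_+)^{m + |E(K_n)|}`-lifts of `P_PM(K_n)`** (`b, m ≥ 1`): Edmonds'
description turns `P_PM(K_n)` into a polytope with both descriptions, the block factorization of the odd-cut slack
matrix extends to the full Edmonds slack matrix with `|E(K_n)| = C(n,2)` extra blocks
(`hasPsdPowerFactorization_edmonds`), and Gouveia–Parrilo–Thomas ("factorization ⇒ lift",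
`hasPsdPowerFactorization_slack_iff_hasBlockPsdLift`) produces the lift. Together with
`hasBlockPsdFactorization_of_hasBlockPsdLift` (lift ⇒ factorization, same `b`, `m`): the cell's currency
`HasBlockPsdFactorization n b m` and "(S^b_+)^m-lifts of P_PM(n)" agree up to `C(n,2)` blocks, so exponential
lower bounds transfer in both directions. [cite: GouveiaParriloThomas2013, Thm. 2.4 (§2)]
[cite: FawziParrilo2013, Thm. 2 (§2.1, p. 6)] [cite: KorteVygen2018, Thm. 11.15 (p. 297)] -/
theorem HasBlockPsdFactorization.hasBlockPsdLift {b m : ℕ} (hb : 1 ≤ b) (hm : 1 ≤ m)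
    (h : HasBlockPsdFactorization n b m) : HasBlockPsdLift (pmPolytope n) b (m + Fintype.card (EKn n)) := by
  rw [← convexHull_range_pmVertex]
  exact (hasPsdPowerFactorization_slack_iff_hasBlockPsdLift hb (by omega)
    (convexHull_range_pmVertex_eq_setOf n)).1 (h.hasPsdPowerFactorization_edmonds hb)

/-- **The equivalence, lower-bound form**: if every `(S^b_+)^r`-lift of `P_PM(K_n)` needs `r ≥ R`, then every
block psd factorization with blocks of size `b` has `m + C(n,2) ≥ R`; conversely
(`hasBlockPsdFactorization_of_hasBlockPsdLift`) bounds on `m` are bounds on lifts.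
[cite: GouveiaParriloThomas2013, Thm. 2.4 (§2)] [cite: FawziParrilo2013, §1.2 (p. 4–5)] -/
theorem HasBlockPsdFactorization.le_add_card_of_lift_bound {b m R : ℕ} (hb : 1 ≤ b) (hm : 1 ≤ m)
    (hR : ∀ r, HasBlockPsdLift (pmPolytope n) b r → R ≤ r) (h : HasBlockPsdFactorization n b m) :
    R ≤ m + Fintype.card (EKn n) :=
  hR _ (h.hasBlockPsdLift hb hm)

end Literature.Combinatorics.Optimization
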